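import Literature.NumberTheory.EllipticCurves.PadicPointsFiltrationProofs
import Literature.NumberTheory.EllipticCurves.ReductionHomomorphismSurjectiveProofs
import Literature.NumberTheory.EllipticCurves.TamagawaSubgroupProofs
import Literature.NumberTheory.EllipticCurves.TamagawaVariableChangeProofs
import Mathlib.NumberTheory.Padics.RingHoms
import HarnessLib

/-!
# The index of the formal filtration: `[E(ℚ_p) : E⁽ⁿ⁾(ℚ_p)] = c_p · #Ẽ_ns(𝔽_p) · pⁿ⁻¹`

Topic `NumberTheory/EllipticCurves`; a proofs-only file (theorems only: no definitions, no named
facts).  For an elliptic curve over `ℚ_p` given by a `ℤ_p`-minimal Weierstrass equation `W`, the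
chain `E(ℚ_p) ⊇ E₀(ℚ_p) ⊇ E₁(ℚ_p) = E⁽¹⁾ ⊇ E⁽²⁾ ⊇ ⋯` (Silverman, *AEC*, VII.2.1, IV.3.2, VII.6.3)
has successive indices `c_p = [E(ℚ_p) : E₀(ℚ_p)]` (the Tamagawa number,
`WeierstrassCurve.localTamagawaNumber`), `#Ẽ_ns(𝔽_p)` (the reduction `E₀(ℚ_p) → Ẽ_ns(𝔽_p)` is
onto with kernel `E₁(ℚ_p)`, *AEC* VII.2.1 — the tree's `WeierstrassCurve.reductionHom_surjective`
and `reductionHom_ker`), and `p` at each further step (`E⁽ⁿ⁾/E⁽ⁿ⁺¹⁾ ≅ pⁿℤ_p/pⁿ⁺¹ℤ_p`, *AEC*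
IV.3.2(a) with VII.2.2).  Hence

* `WeierstrassCurve.index_formalFiltration`:
  **`[E(ℚ_p) : E⁽ⁿ⁾(ℚ_p)] = c_p · #Ẽ_ns(𝔽_p) · pⁿ⁻¹`** for `n ≥ 1`
  (`E⁽ⁿ⁾ = W.formalFiltration n` of `PadicPointsFiltration`, `#Ẽ_ns(𝔽_p)` = the number of points
  of Mathlib's `W.reduction ℤ_[p]`, whose `Point` type consists of the nonsingular points).

This is the integrality content of the classical formula
`∫_{E(ℚ_p)} |ω| = c_p · #Ẽ_ns(𝔽_p)/p` for the `p`-adic volume of a minimal model (Tate; Milne,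
*Arithmetic Duality Theorems*, I.7, the local factors `μ_v(A, ω)` in the conjecture of Birch and
Swinnerton-Dyer, with `μ_v = #Ã(k_v)/q^d` at good `v`), in the measure-free form in which it enters
the tree's proof of the isogeny invariance of the BSD quotient (Milne ADT Thm. I.7.3, the named fact
`WeierstrassCurve.bsdRHS_eq_of_isIsogenous`; sibling file `PadicFiltrationLinearTermProofs`).

Steps (all proved here):
* `WeierstrassCurve.kernelOfReduction_eq_formalFiltration_zero`: `E₁(ℚ_p) = E⁽⁰⁾` (the kernel of
  reduction of `ReductionHomomorphism.lean` is the level-`0` formal subgroup of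
  `PadicPointsFiltration.lean`);
* `WeierstrassCurve.formalFiltration_one_eq_zero`: `E⁽¹⁾ = E⁽⁰⁾` (norms on `ℚ_p` are powers of `p`);
* `WeierstrassCurve.relIndex_formalFiltration_succ`: `[E⁽ⁿ⁾ : E⁽ⁿ⁺¹⁾] = p` for `n ≥ 1`, through
  the homomorphism `P ↦ z(P)/pⁿ mod p` onto `ℤ/p` (additive because
  `‖z(P + Q) - z(P) - z(Q)‖ ≤ max(‖z(P)‖, ‖z(Q)‖)²`, the tree's
  `norm_formalParameter_add_sub_sub_le`; onto by the inverse dictionary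
  `exists_isInReductionKernel_formalParameter_eq`);
* `WeierstrassCurve.relIndex_formalFiltration_one`: `[E⁽¹⁾ : E⁽ⁿ⁾] = pⁿ⁻¹`;
* `WeierstrassCurve.relIndex_kernelOfReduction`: `[E₀(ℚ_p) : E₁(ℚ_p)] = #Ẽ_ns(𝔽_p)`;
* `WeierstrassCurve.localTamagawaNumber_eq_index_of_isMinimal`: for a minimal `W`,
  `c_p = [E(ℚ_p) : E₀(ℚ_p)]` computed on `W` itself (Mathlib's `W.minimal ℤ_[p]` is
  `ℚ_p`-isomorphic to `W`; `index_goodReductionSubgroup_eq_of_eq_smul`).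

## References

* J. H. Silverman, *The Arithmetic of Elliptic Curves*, 2nd ed., GTM 106 (2009), IV.3.2(a),
  VII.2.1–2.2, VII.6.1–6.3, Exercise 7.4. [SilvermanAEC2009]
* J. S. Milne, *Arithmetic Duality Theorems*, 2nd ed. (2006), Ch. I §7 (the local factors `μ_v`),
  proof of Thm. 7.3, p. 98. [MilneADT2006]
* J. Tate, *Algorithm for determining the type of a singular fiber in an elliptic pencil*,
  Antwerp IV, LNM 476 (1975), §1. [IV1975]

## Design

Theorems only (D-0026); `noncomputable section`, `open scoped Classical` as in the files it
combines.  Statements about the reduction are made for an equation `W₀` with coefficients in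
`ℤ_[p]` and the canonical valuation of `ReductionHomomorphism.lean`
(`Literature.NumberTheory.EllipticCurves.integers_valuationRing_valuation ℤ_[p] ℚ_[p]`); the final
index formula is for any `ℤ_p`-minimal `W` over `ℚ_p` (`IsIntegral.integral` produces `W₀`).
-/

noncomputable section

open scoped Classical
open Literature.NumberTheory.EllipticCurves

namespace WeierstrassCurve

variable {p : ℕ} [Fact p.Prime]

omit [Fact p.Prime] in
/-- `(p⁻¹)ⁿ = p^{-n}` in `ℝ` (bookkeeping between the two ways of writing the radii). [folklore] -/
theorem inv_natCast_pow_eq_zpow_neg (n : ℕ) : ((p : ℝ)⁻¹) ^ n = (p : ℝ) ^ (-(n : ℤ)) := by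
  rw [inv_pow, ← zpow_natCast, ← zpow_neg]

/-- On `ℚ_p`, `‖x‖ < p⁻ⁿ ↔ ‖x‖ ≤ p⁻⁽ⁿ⁺¹⁾` (norms are integral powers of `p`). [folklore] -/
theorem padicNorm_lt_inv_pow_iff_le (x : ℚ_[p]) (n : ℕ) :
    ‖x‖ < ((p : ℝ)⁻¹) ^ n ↔ ‖x‖ ≤ ((p : ℝ)⁻¹) ^ (n + 1) := by
  rw [inv_natCast_pow_eq_zpow_neg, inv_natCast_pow_eq_zpow_neg,
    Padic.norm_le_pow_iff_norm_lt_pow_add_one]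
  push_cast
  ring_nf

section Levels

variable (W : WeierstrassCurve ℚ_[p]) [hW : W.IsIntegral ℤ_[p]] [W.IsElliptic]

/-- **`E⁽¹⁾(ℚ_p) = E⁽⁰⁾(ℚ_p) = E₁(ℚ_p)`**: on the kernel of reduction `‖z(P)‖ < 1`, hence
`‖z(P)‖ ≤ p⁻¹`. [Silverman AEC VII.2.2 (`E₁(K) ≅ Ê(𝓜)`)] [folklore] -/
theorem formalFiltration_one_eq_zero : W.formalFiltration 1 = W.formalFiltration 0 := by
  refine le_antisymm (W.formalFiltration_antitone zero_le_one) fun P hP => ⟨hP.1, ?_⟩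
  rw [← padicNorm_lt_inv_pow_iff_le, pow_zero]
  exact W.norm_formalParameter_lt_one hP.1

/-- **`[E⁽ⁿ⁾ : E⁽ⁿ⁺¹⁾] = p` for `n ≥ 1`** (Silverman, *AEC* IV.3.2(a): `Ê(𝓜ⁿ)/Ê(𝓜ⁿ⁺¹) ≅ 𝓜ⁿ/𝓜ⁿ⁺¹`,
transported to `E₁(ℚ_p)` by VII.2.2).  Proof: `P ↦ z(P)/pⁿ mod p` is a homomorphism
`E⁽ⁿ⁾ → ℤ/p` (`‖z(P+Q) - z(P) - z(Q)‖ ≤ max(‖z(P)‖,‖z(Q)‖)² ≤ p⁻²ⁿ < p⁻ⁿ`), with kernel `E⁽ⁿ⁺¹⁾`,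
and onto (every `t` with `‖t‖ < 1` is a parameter `z(P)`).
[cite: SilvermanAEC2009, IV.3.2(a) with VII.2.2] -/
theorem relIndex_formalFiltration_succ {n : ℕ} (hn : 1 ≤ n) :
    (W.formalFiltration (n + 1)).relIndex (W.formalFiltration n) = p := by
  have hp0 : (p : ℚ_[p]) ≠ 0 := Nat.cast_ne_zero.mpr (Fact.out : p.Prime).ne_zero
  have hpn : (p : ℚ_[p]) ^ n ≠ 0 := pow_ne_zero _ hp0
  have hpR : (0 : ℝ) < p := by exact_mod_cast (Fact.out : p.Prime).pos
  have hp1 : (p : ℝ)⁻¹ < 1 := inv_lt_one_of_one_lt₀ (by exact_mod_cast (Fact.out : p.Prime).one_lt)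
  have hp0' : (0 : ℝ) < (p : ℝ)⁻¹ := inv_pos.mpr hpR
  have hnormpn : ‖(p : ℚ_[p]) ^ n‖ = ((p : ℝ)⁻¹) ^ n := by rw [norm_pow, Padic.norm_p]
  -- the integer `z(P)/pⁿ`
  have hint : ∀ P ∈ W.formalFiltration n, ‖W.formalParameter P / (p : ℚ_[p]) ^ n‖ ≤ 1 := by
    intro P hP
    rw [norm_div, hnormpn, div_le_one (pow_pos hp0' _)]
    exact hP.2
  set u : W.formalFiltration n → ℤ_[p] := fun P => ⟨W.formalParameter P / (p : ℚ_[p]) ^ n, hint P P.2⟩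
    with hu
  have hu_coe : ∀ P : W.formalFiltration n, (u P : ℚ_[p]) = W.formalParameter P / (p : ℚ_[p]) ^ n :=
    fun P => rfl
  -- additivity modulo `p`
  have hu_add : ∀ P Q : W.formalFiltration n,
      PadicInt.toZMod (u (P + Q)) = PadicInt.toZMod (u P) + PadicInt.toZMod (u Q) := by
    intro P Q
    rw [← map_add, ← sub_eq_zero, ← map_sub, ← RingHom.mem_ker, PadicInt.ker_toZMod,
      IsLocalRing.mem_maximalIdeal, PadicInt.mem_nonunits, PadicInt.norm_def]
    have hcoe : ((u (P + Q) - (u P + u Q) : ℤ_[p]) : ℚ_[p]) =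
        (W.formalParameter ((P : W.toAffine.Point) + Q) - W.formalParameter P - W.formalParameter Q) /
          (p : ℚ_[p]) ^ n := by
      push_cast
      rw [hu_coe, hu_coe, hu_coe, AddSubgroup.coe_add]
      ring
    rw [hcoe, norm_div, hnormpn, div_lt_one (pow_pos hp0' _)]
    refine (W.norm_formalParameter_add_sub_sub_le P.2.1 Q.2.1).trans_lt ?_
    have hmax : max ‖W.formalParameter (P : W.toAffine.Point)‖ ‖W.formalParameter (Q : W.toAffine.Point)‖ ≤
        ((p : ℝ)⁻¹) ^ n := max_le P.2.2 Q.2.2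
    calc (max ‖W.formalParameter (P : W.toAffine.Point)‖ ‖W.formalParameter (Q : W.toAffine.Point)‖) ^ 2
        ≤ (((p : ℝ)⁻¹) ^ n) ^ 2 := pow_le_pow_left₀ (le_max_of_le_left (norm_nonneg _)) hmax 2
      _ < ((p : ℝ)⁻¹) ^ n := by
          rw [pow_two]
          exact mul_lt_of_lt_one_left (pow_pos hp0' _) (pow_lt_one₀ hp0'.le hp1 (by omega))
  set g : W.formalFiltration n →+ ZMod p := AddMonoidHom.mk' (fun P => PadicInt.toZMod (u P)) hu_add
    with hg
  -- kernel `= E⁽ⁿ⁺¹⁾`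
  have hker : g.ker = (W.formalFiltration (n + 1)).addSubgroupOf (W.formalFiltration n) := by
    ext P
    rw [AddMonoidHom.mem_ker, AddSubgroup.mem_addSubgroupOf, hg, AddMonoidHom.mk'_apply,
      ← RingHom.mem_ker, PadicInt.ker_toZMod, IsLocalRing.mem_maximalIdeal, PadicInt.mem_nonunits,
      PadicInt.norm_def, hu_coe, norm_div, hnormpn, div_lt_one (pow_pos hp0' _),
      padicNorm_lt_inv_pow_iff_le, mem_formalFiltration_iff]
    exact ⟨fun h => ⟨P.2.1, h⟩, fun h => h.2⟩
  -- onto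
  have hsurj : Function.Surjective g := by
    intro c
    set t : ℚ_[p] := (p : ℚ_[p]) ^ n * (c.val : ℚ_[p]) with ht
    have htn : ‖t‖ ≤ ((p : ℝ)⁻¹) ^ n := by
      rw [ht, norm_mul, hnormpn]
      exact mul_le_of_le_one_right (pow_nonneg hp0'.le _)
        (by simpa using Padic.norm_int_le_one (p := p) (c.val : ℤ))
    have ht1 : ‖t‖ < 1 := htn.trans_lt (pow_lt_one₀ hp0'.le hp1 (by omega))
    obtain ⟨P, hP1, hPz⟩ := W.exists_isInReductionKernel_formalParameter_eq ht1
    have hPn : P ∈ W.formalFiltration n := ⟨hP1, by rw [hPz]; exact htn⟩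
    refine ⟨⟨P, hPn⟩, ?_⟩
    rw [hg, AddMonoidHom.mk'_apply]
    have huP : u ⟨P, hPn⟩ = (c.val : ℤ_[p]) := by
      refine Subtype.ext ?_
      rw [hu_coe, PadicInt.coe_natCast]
      change W.formalParameter P / (p : ℚ_[p]) ^ n = _
      rw [hPz, ht, mul_div_cancel_left₀ _ hpn]
    rw [huP, map_natCast, ZMod.natCast_zmod_val]
  rw [AddSubgroup.relIndex, ← hker, AddSubgroup.index_ker, AddMonoidHom.range_eq_top.mpr hsurj,
    AddSubgroup.card_top, Nat.card_zmod]

/-- **`[E⁽¹⁾ : E⁽ⁿ⁾] = pⁿ⁻¹`** for `n ≥ 1`. [cite: SilvermanAEC2009, IV.3.2(a) with VII.2.2] -/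
theorem relIndex_formalFiltration_one {n : ℕ} (hn : 1 ≤ n) :
    (W.formalFiltration n).relIndex (W.formalFiltration 1) = p ^ (n - 1) := by
  obtain ⟨m, rfl⟩ : ∃ m, n = m + 1 := ⟨n - 1, by omega⟩
  rw [Nat.add_sub_cancel]
  induction m with
  | zero => rw [zero_add, pow_zero, AddSubgroup.relIndex_self]
  | succ m ih =>
    rw [← AddSubgroup.relIndex_mul_relIndex _ _ _ (W.formalFiltration_antitone (Nat.le_succ (m + 1)))
        (W.formalFiltration_antitone (by omega : 1 ≤ m + 1)),
      W.relIndex_formalFiltration_succ (by omega), ih (by omega), pow_succ, mul_comm]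

end Levels

section Reduction

/-- **`E₁(ℚ_p)` of `ReductionHomomorphism.lean` is `E⁽⁰⁾(ℚ_p)` of `PadicPointsFiltration.lean`**
(for an equation `W₀` with `ℤ_p`-coefficients): an affine point reduces to `Õ` iff its
`x`-coordinate is not a `p`-adic integer iff `‖x‖ > 1`. [Silverman AEC VII.2] [folklore] -/
theorem kernelOfReduction_eq_formalFiltration_zero (W₀ : WeierstrassCurve ℤ_[p])
    [(W₀.baseChange ℚ_[p]).IsIntegral ℤ_[p]] [(W₀.baseChange ℚ_[p]).IsElliptic] :
    W₀.kernelOfReduction (integers_valuationRing_valuation ℤ_[p] ℚ_[p]) =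
      (W₀.baseChange ℚ_[p]).formalFiltration 0 := by
  ext P
  rw [mem_kernelOfReduction_iff, mem_formalFiltration_zero_iff]
  rcases P with _ | ⟨x, y, h⟩
  · exact ⟨fun _ => (W₀.baseChange ℚ_[p]).isInReductionKernel_zero, fun _ => reducesToZero_zero⟩
  · rw [reducesToZero_some_iff, isInReductionKernel_some, Set.mem_range, not_exists]
    constructor
    · intro hx
      by_contra hle
      exact hx ⟨x, not_lt.mp hle⟩ rfl
    · rintro hx z rfl
      exact absurd hx (not_lt.mpr (PadicInt.norm_le_one z))

/-- **`[E₀(ℚ_p) : E₁(ℚ_p)] = #Ẽ_ns(𝔽_p)`**: the reduction homomorphism `E₀(ℚ_p) → Ẽ_ns(𝔽_p)` is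
onto (`ℤ_p` is henselian; Silverman, *AEC* VII.2.1, the tree's `reductionHom_surjective`) with
kernel `E₁(ℚ_p)` (`reductionHom_ker`); `Ẽ_ns(𝔽_p)` is the group of points of the reduced cubic
`W₀ mod p` in Mathlib's sense (nonsingular points only).
[cite: SilvermanAEC2009, VII.2 Prop. 2.1 (PDF p. 167)] -/
theorem relIndex_kernelOfReduction (W₀ : WeierstrassCurve ℤ_[p]) :
    (W₀.kernelOfReduction (integers_valuationRing_valuation ℤ_[p] ℚ_[p])).relIndex
        (W₀.nonsingularReductionSubgroup (integers_valuationRing_valuation ℤ_[p] ℚ_[p])) =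
      Nat.card (W₀.map (IsLocalRing.residue ℤ_[p])).toAffine.Point := by
  set hv := integers_valuationRing_valuation ℤ_[p] ℚ_[p]
  rw [AddSubgroup.relIndex, ← reductionHom_ker, AddSubgroup.index_ker,
    AddMonoidHom.range_eq_top.mpr (W₀.reductionHom_surjective hv), AddSubgroup.card_top]

/-- **`c_p = [E(ℚ_p) : E₀(ℚ_p)]` on any minimal equation**: Mathlib's `W.minimal ℤ_[p]` is
`D • W` for a change of variables `D` over `ℚ_p`, and two `ℚ_p`-isomorphic minimal equations of
an elliptic curve have the same index `[E : E₀]`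
(`index_goodReductionSubgroup_eq_of_eq_smul`, Silverman *AEC* VII.1.3(b)).
[cite: SilvermanAEC2009, VII.1 Prop. 1.3(b) and VII.6 Ex. 7.6] -/
theorem localTamagawaNumber_eq_index_of_isMinimal (W : WeierstrassCurve ℚ_[p]) [W.IsMinimal ℤ_[p]]
    [W.IsElliptic] : W.localTamagawaNumber ℤ_[p] = (W.goodReductionSubgroup ℤ_[p]).index :=
  index_goodReductionSubgroup_eq_of_eq_smul ℤ_[p] (D := (W.exists_isMinimal ℤ_[p]).choose) rfl
    W.isUnit_Δ.ne_zero

end Reduction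

/-- **The index of the formal filtration** (Silverman, *AEC* VII.2.1, IV.3.2, VII.6; the integral
form of Tate's `∫_{E(ℚ_p)}|ω| = c_p #Ẽ_ns(𝔽_p)/p`, Milne *ADT* I.7): for an elliptic curve over
`ℚ_p` with `ℤ_p`-minimal equation `W` and `n ≥ 1`,
`[E(ℚ_p) : E⁽ⁿ⁾(ℚ_p)] = c_p · #Ẽ_ns(𝔽_p) · pⁿ⁻¹`, where `c_p = W.localTamagawaNumber ℤ_[p]` and
`#Ẽ_ns(𝔽_p)` is the number of points (nonsingular ones together with `Õ`, i.e. Mathlib's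
`Point`) of the reduction `W.reduction ℤ_[p]`.
[cite: SilvermanAEC2009, VII.2 Prop. 2.1, IV.3.2(a), VII.6.1] -/
theorem index_formalFiltration (W : WeierstrassCurve ℚ_[p]) [W.IsMinimal ℤ_[p]] [W.IsElliptic]
    {n : ℕ} (hn : 1 ≤ n) :
    (W.formalFiltration n).index =
      W.localTamagawaNumber ℤ_[p] * Nat.card (W.reduction ℤ_[p]).toAffine.Point * p ^ (n - 1) := by
  obtain ⟨W₀, hW₀⟩ : ∃ W₀ : WeierstrassCurve ℤ_[p], W = W₀.baseChange ℚ_[p] := IsIntegral.integral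
  subst hW₀
  set hv := integers_valuationRing_valuation ℤ_[p] ℚ_[p]
  have h10 : (W₀.baseChange ℚ_[p]).formalFiltration 1 = W₀.kernelOfReduction hv := by
    rw [formalFiltration_one_eq_zero, kernelOfReduction_eq_formalFiltration_zero]
  have hE₁E₀ : W₀.kernelOfReduction hv ≤ W₀.nonsingularReductionSubgroup hv :=
    kernelOfReduction_le_nonsingularReductionSubgroup hv
  have hn1 : (W₀.baseChange ℚ_[p]).formalFiltration n ≤ (W₀.baseChange ℚ_[p]).formalFiltration 1 :=
    (W₀.baseChange ℚ_[p]).formalFiltration_antitone hn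
  rw [← AddSubgroup.relIndex_mul_index hn1, relIndex_formalFiltration_one _ hn, h10,
    ← AddSubgroup.relIndex_mul_index hE₁E₀, relIndex_kernelOfReduction,
    ← goodReductionSubgroup_baseChange_eq, ← localTamagawaNumber_eq_index_of_isMinimal,
    reduction_baseChange_eq]
  ring

end WeierstrassCurve
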